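/-
Copyright (c) 2026.  Released under the Apache 2.0 license of this project.
Cell decomp-a2c, lens 4 (minimal-counterexample / extremal reduction), generation 68 — critic row 1207 (B) (D1)/(D2).
-/
import Summits.AtomisticToContinuum.Crystallization.Theorems.OverbindingBudgetAffineHcpReference
import Summits.AtomisticToContinuum.Crystallization.Theorems.OverbindingBudgetAffineRadialReduction

/-!
# The radial-table glue: `hcert` of `farCoreExcess_of_hcpEnclosures` from `FamilyData.radial_reduction` and a chart dictionary

Critic row 1207 (B) registered the radial reduction (`…OverbindingBudgetAffineRadialReduction`, PROVED) as a
sibling CERT-line under leaf Z2 of slot Z «of record only when the glue is typed»: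

* (D1) `hcert_of_radialTables`: derive the binder `hcert` of the landed
  `OverbindingBudgetAffineFarSmoothSplit.farCoreExcess_of_hcpEnclosures` VERBATIM from
  `FamilyData.radial_reduction` and a CHART DICTIONARY, with the dictionary's claim «`b ≤ ψ x` gives
  `T₃↑²·L6hi ≤ (l3² − 24κ″L6hi)·T₆↓`, scale-free so that ONE chart serves every pinning scale» as a Lean
  statement, including the obligation that every admissible far window's chart point lies in the chart
  region `K`;
* (D2) the side condition that the far clause keeps every chart point at distance `≥ r₁` from the class
  centre.

This file TYPES that glue and PROVES it, leaving exactly the dictionary as a named interface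
(`ChartDictionary`, §2) to be CONSTRUCTED by the kernel side (one instance per structure class; no existence
is assumed here — every theorem takes the dictionary as an explicit argument):

* §1 the scale-free algebra (`table_of_ratio`, `cert_of_table`): if `ν > 0` is any normalising length of the
  window, `ν⁶·T₃↑ ≤ P(x)` (upper enclosure of the cube sum in chart units), `N(x) ≤ ν¹²·T₆↓` (lower enclosure of
  the sixth-power sum) and `b ≤ ψ(x) = N(x)/P(x)²`, then `b·T₃↑² ≤ T₆↓`; and `L6hi ≤ b·(l3² − 24κ″L6hi)` turns
  this into the `hcert` inequality.  The powers of `ν` cancel: this is the precise sense in which the chart is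
  scale-free.
* §2 the pinning scale `μ` of a far window (the attained minimum of the 12 first-shell lengths, the `∃ μ` of
  `FarWindowData`) is unique (`pinningScale_unique`), so the far clause holds AT it (`far_at_pinningScale`) and it is positive
  (`pinningScale_pos_of_farWindowData`); and the interface `ChartDictionary θ θ' w D K x₀ r₁` of ONE sign window
  `w` (one structure class): a chart map `(X, μ) ↦ x ∈ E` and a normalising length `scale X μ` (the pinning scale, or the
  length `‖X u‖` of one fixed first-shell vector — `ψ` is homogeneous of degree `0`, so ONE chart per class and no
  case analysis on which first-shell vector is the shortest) together with the five obligations `scale_pos`, `mem_K` (the chart point of every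
  admissible far window lies in `K` — in the intended instance this is where the near-isometry clause
  `‖X v − Q v‖ ≤ 3θ‖v‖` of `FarWindowData` gives the anisotropy cap `((1+3θ)/(1−3θ))² = (28/22)²` at
  `θ = 1/25`), `far` (the far clause `∀ Q, ∃ t ∈ twoShellIdx, θ'μ < ‖X t − μ Q t‖` excludes the Gram ball of
  radius `r₁` about `x₀` — (D2)), `upper`, `lower` (the two enclosures by the inverse-power family `D` with
  far-field constants `D.F₃ = F₆⁺`, `D.F₆ = F₁₂⁻`), each stated for a far window `(w, X)` and a scale `μ`
  that is a lower bound of the first-shell lengths attained at one of them.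
* §3 per window: the RATIO table `∀ X, FarWindowData θ θ' w X → b·T₃↑(w,X)² ≤ T₆↓(w,X)` of `w` from its
  dictionary and EITHER ◇ a VALUE table `∀ x ∈ K, r₁ ≤ ‖x − x₀‖ → b ≤ ψ x` (`table_of_valueTable` — the
  interface of the line of record, critic row 1196: kernel value cells + `cover_sound5` of the generation-67
  leaf; the same dictionary serves it) OR ★ the RADIAL tables (C), (B), (G) of `FamilyData.radial_reduction`
  (`table_of_radialTables` — the sibling line); the choice is per class.
* §4 assembly over the windows: ◇◇ `hcert_of_ratioTables` (the `hcert` binder verbatim from the ratio tables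
  of all windows) and ◇◇◇ `farCoreExcess_of_ratioTables` (composition with `farCoreExcess_of_hcpEnclosures`).
* §5 end to end: ★★ `hcert_of_radialTables` — (D1) literally: `hcert` from per-window chart dictionaries and
  radial tables — and ★★★ `farCoreExcess_of_radialTables`: `FarCoreExcess (1/25) (1/2000) (1/(2·10⁷))` from
  the hcp reference enclosures, a chart dictionary per window at `θ = 1/25`, `θ' = 1/2000 − τ`, and the radial
  tables.

Intended instance (generation 69, kernel side): `E = EuclideanSpace ℝ (Fin 5)` = the five free entries of
the pinned Gram matrix `G = (X A)ᵀ(X A)/μ²` (`A` = reduced hcp coordinates of the window, `G₀₀ = 1` pinned by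
the minimising first-shell vector moved to the reference position by the 12-element site symmetry of the
generation-67 leaf §11), `ι` = the window-vector family `hcpVecs`, `c_v + L_v x = vᵀ G v / 9`, `K` = the convex
region `{G₀₀ = 1} ∩ {anisotropy ≤ (28/22)²}`, `x₀` = the hcp Gram point of the class.
No `sorry`, no new axioms; nothing of the slot is restated (all far-window notions are the tree's, by name).
-/

open Set

namespace Summit.AtomisticToContinuum.Crystallization.Theorems.OverbindingBudgetAffineRadialGlue

open Summit.AtomisticToContinuum.Crystallization.Theorems.OverbindingBudgetAffineFarSmoothSplit
open Summit.AtomisticToContinuum.Crystallization.Theorems.OverbindingBudgetAffineRadialReduction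
open Literature.MathematicalPhysics.StatisticalMechanics

local notation "E3" => EuclideanSpace ℝ (Fin 3)

/-! ## §1 The scale-free algebra -/

/-- If `μ > 0`, `μ⁶T₃ ≤ P`, `N ≤ μ¹²T₆`, `0 < P` and `b ≤ N/P²` with `b, T₃ ≥ 0`, then `b·T₃² ≤ T₆`: the powers of the
pinning scale cancel. -/
theorem table_of_ratio {μ T3 T6 P N b : ℝ} (hμ : 0 < μ) (hT3 : 0 ≤ T3) (hb : 0 ≤ b)
    (hU : μ ^ 6 * T3 ≤ P) (hL : N ≤ μ ^ 12 * T6) (hP : 0 < P) (hψ : b ≤ N / P ^ 2) :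
    b * T3 ^ 2 ≤ T6 := by
  have h1 : b * P ^ 2 ≤ N := by rwa [le_div_iff₀ (by positivity)] at hψ
  have h2 : (μ ^ 6 * T3) ^ 2 ≤ P ^ 2 := pow_le_pow_left₀ (by positivity) hU 2
  have h3 : μ ^ 12 * (b * T3 ^ 2) ≤ μ ^ 12 * T6 :=
    calc μ ^ 12 * (b * T3 ^ 2) = b * (μ ^ 6 * T3) ^ 2 := by ring
      _ ≤ b * P ^ 2 := mul_le_mul_of_nonneg_left h2 hb
      _ ≤ N := h1
      _ ≤ μ ^ 12 * T6 := hL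
  exact le_of_mul_le_mul_left h3 (by positivity)

/-- `b·T₃² ≤ T₆` with `L6hi ≤ b·(l3² − κL6hi)` and `0 ≤ l3² − κL6hi` gives the table inequality
`T₃²·L6hi ≤ (l3² − κL6hi)·T₆`. -/
theorem cert_of_table {T3 T6 b l3 L6hi κ : ℝ} (hD : 0 ≤ l3 ^ 2 - κ * L6hi)
    (hbD : L6hi ≤ b * (l3 ^ 2 - κ * L6hi)) (h : b * T3 ^ 2 ≤ T6) :
    T3 ^ 2 * L6hi ≤ (l3 ^ 2 - κ * L6hi) * T6 :=
  calc T3 ^ 2 * L6hi ≤ T3 ^ 2 * (b * (l3 ^ 2 - κ * L6hi)) := mul_le_mul_of_nonneg_left hbD (sq_nonneg T3)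
    _ = (l3 ^ 2 - κ * L6hi) * (b * T3 ^ 2) := by ring
    _ ≤ (l3 ^ 2 - κ * L6hi) * T6 := mul_le_mul_of_nonneg_left h hD

/-! ## §2 The pinning scale, and the chart dictionary -/

section Scale

variable {θ θ' : ℝ} {w : Fin 6 → ℤ} {X : E3 →ₗ[ℝ] E3} {μ : ℝ}

/-- The pinning scale is unique: two lower bounds of the first-shell lengths, each attained, coincide. [this file] -/
theorem pinningScale_unique {μ' : ℝ} (hmin : ∀ t ∈ firstShellIdx (w 3) (-w 2), μ ≤ ‖X (wPos w t)‖)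
    (hatt : ∃ t ∈ firstShellIdx (w 3) (-w 2), μ = ‖X (wPos w t)‖)
    (hmin' : ∀ t ∈ firstShellIdx (w 3) (-w 2), μ' ≤ ‖X (wPos w t)‖)
    (hatt' : ∃ t ∈ firstShellIdx (w 3) (-w 2), μ' = ‖X (wPos w t)‖) : μ' = μ := by
  obtain ⟨t, ht, h⟩ := hatt
  obtain ⟨t', ht', h'⟩ := hatt'
  exact le_antisymm (h ▸ hmin' t ht) (h' ▸ hmin t' ht')

/-- The far clause of `FarWindowData` holds at THE pinning scale (any attained lower bound of the first-shell lengths).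
[this file] -/
theorem far_at_pinningScale (hX : FarWindowData θ θ' w X) (hmin : ∀ t ∈ firstShellIdx (w 3) (-w 2), μ ≤ ‖X (wPos w t)‖)
    (hatt : ∃ t ∈ firstShellIdx (w 3) (-w 2), μ = ‖X (wPos w t)‖) :
    ∀ Q : E3 →ₗᵢ[ℝ] E3, ∃ t ∈ twoShellIdx (w 3) (-w 2), θ' * μ < ‖X (wPos w t) - μ • Q (wPos w t)‖ := by
  obtain ⟨-, -, μ', hmin', hatt', hfar⟩ := hX
  rw [← pinningScale_unique hmin hatt hmin' hatt']
  exact hfar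

/-- The pinning scale is positive as soon as the attained first-shell vector is nonzero:
`μ = ‖X v‖ ≥ ‖Q v‖ − 3θ‖v‖ = (1 − 3θ)‖v‖ > 0` (`3θ < 1`). [this file] -/
theorem pinningScale_pos_of_farWindowData (hθ : 3 * θ < 1) (hX : FarWindowData θ θ' w X)
    (hatt : ∃ t ∈ firstShellIdx (w 3) (-w 2), μ = ‖X (wPos w t)‖)
    (hv : ∀ t ∈ firstShellIdx (w 3) (-w 2), wPos w t ≠ 0) : 0 < μ := by
  obtain ⟨-, ⟨Q, hQ⟩, -⟩ := hX
  obtain ⟨t, ht, rfl⟩ := hatt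
  have hv' : 0 < ‖wPos w t‖ := norm_pos_iff.2 (hv t ht)
  have h1 : ‖Q (wPos w t)‖ = ‖wPos w t‖ := Q.norm_map _
  have h2 : ‖Q (wPos w t)‖ - ‖X (wPos w t) - Q (wPos w t)‖ ≤ ‖X (wPos w t)‖ := by
    have := norm_sub_norm_le (Q (wPos w t)) (Q (wPos w t) - X (wPos w t))
    rw [sub_sub_cancel, ← norm_neg (Q (wPos w t) - X (wPos w t)), neg_sub] at this
    linarith
  have h3 := hQ (wPos w t)
  nlinarith

end Scale

/-- The CHART DICTIONARY of a sign window `w` (one structure class) at tolerances `(θ, θ')`: a chart map sending a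
far window `(w, X)` with pinning scale `μ` to a point of the chart space `E`, a NORMALISING LENGTH `scale X μ > 0`
(the pinning scale `μ` itself, or the length `‖X u‖` of one FIXED first-shell vector `u` — `ψ = N/P²` is homogeneous
of degree `0` in the lengths, so any choice serves, and the fixed-vector choice gives ONE chart per class with no case
analysis on which of the 12 first-shell vectors is the shortest), an inverse-power family `D` on `E` (centres `c_i`,
linear parts `L_i`, far-field constants `F₃ = F₆⁺`, `F₆ = F₁₂⁻`), a chart region `K`, the class centre `x₀` and the
excluded radius `r₁`, WITH the five obligations that make a table on the chart imply the far-window table of `w`;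
every obligation is stated for `FarWindowData θ θ' w X` and a scale `μ` that is a lower bound of the 12 first-shell
lengths attained at one of them (the `∃ μ` of `FarWindowData`, unique by `pinningScale_unique`).  This is an
interface to be CONSTRUCTED (one instance per window / class); no theorem below assumes an instance exists. -/
structure ChartDictionary {E : Type*} [NormedAddCommGroup E] [NormedSpace ℝ E] {ι : Type*}
    (θ θ' : ℝ) (w : Fin 6 → ℤ) (D : FamilyData E ι) (K : Set E) (x₀ : E) (r₁ : ℝ) where
  /-- the chart point of a far window (given its pinning scale) -/
  chart : (E3 →ₗ[ℝ] E3) → ℝ → E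
  /-- the normalising length of the chart (the pinning scale, or `‖X u‖` for a fixed first-shell vector `u`) -/
  scale : (E3 →ₗ[ℝ] E3) → ℝ → ℝ
  /-- the normalising length is positive (for the pinning scale: `pinningScale_pos_of_farWindowData`) -/
  scale_pos : ∀ (X : E3 →ₗ[ℝ] E3) (μ : ℝ), FarWindowData θ θ' w X →
    (∀ t ∈ firstShellIdx (w 3) (-w 2), μ ≤ ‖X (wPos w t)‖) → (∃ t ∈ firstShellIdx (w 3) (-w 2), μ = ‖X (wPos w t)‖) →
      0 < scale X μ
  /-- ADMISSIBILITY ⇒ REGION: the chart point of every admissible far window lies in `K` (the near-isometry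
  clause `‖X v − Q v‖ ≤ 3θ‖v‖` bounds the anisotropy of the normalised Gram matrix by `((1+3θ)/(1−3θ))²`) -/
  mem_K : ∀ (X : E3 →ₗ[ℝ] E3) (μ : ℝ), FarWindowData θ θ' w X →
    (∀ t ∈ firstShellIdx (w 3) (-w 2), μ ≤ ‖X (wPos w t)‖) → (∃ t ∈ firstShellIdx (w 3) (-w 2), μ = ‖X (wPos w t)‖) →
      chart X μ ∈ K
  /-- (D2) the far clause (`far_at_pinningScale`) excludes the Gram ball of radius `r₁` about the class centre -/
  far : ∀ (X : E3 →ₗ[ℝ] E3) (μ : ℝ), FarWindowData θ θ' w X →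
    (∀ t ∈ firstShellIdx (w 3) (-w 2), μ ≤ ‖X (wPos w t)‖) → (∃ t ∈ firstShellIdx (w 3) (-w 2), μ = ‖X (wPos w t)‖) →
      r₁ ≤ ‖chart X μ - x₀‖
  /-- UPPER enclosure of the cube window sum in chart units: `scale⁶·T₃↑(w,X) ≤ S₃(x) + F₃` -/
  upper : ∀ (X : E3 →ₗ[ℝ] E3) (μ : ℝ), FarWindowData θ θ' w X →
    (∀ t ∈ firstShellIdx (w 3) (-w 2), μ ≤ ‖X (wPos w t)‖) → (∃ t ∈ firstShellIdx (w 3) (-w 2), μ = ‖X (wPos w t)‖) →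
      scale X μ ^ 6 * windowSixUp w X ≤ D.P (chart X μ)
  /-- LOWER enclosure of the sixth-power window sum in chart units: `S₆(x) + F₆ ≤ scale¹²·T₆↓(w,X)` -/
  lower : ∀ (X : E3 →ₗ[ℝ] E3) (μ : ℝ), FarWindowData θ θ' w X →
    (∀ t ∈ firstShellIdx (w 3) (-w 2), μ ≤ ‖X (wPos w t)‖) → (∃ t ∈ firstShellIdx (w 3) (-w 2), μ = ‖X (wPos w t)‖) →
      D.N (chart X μ) ≤ scale X μ ^ 12 * windowTwelveLo w X

/-! ## §3 The glue, one window at a time: the RATIO table `b·T₃↑² ≤ T₆↓` of a window from a chart table -/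

section Window

variable {E : Type*} [NormedAddCommGroup E] [NormedSpace ℝ E] {ι : Type*} {θ θ' : ℝ} {w : Fin 6 → ℤ}
  {D : FamilyData E ι} {K : Set E} {x₀ : E} {ρ m₀ η δ₀ b r₁ : ℝ}

/-- ◇ **The ratio table of a window from a VALUE table** (the interface of the line of record, critic row 1196:
kernel value cells + `cover_sound5` certify `b ≤ ψ` on `K` outside the excluded ball).  A chart dictionary of `w`,
positivity of `P` on `K` and `∀ x ∈ K, r₁ ≤ ‖x − x₀‖ → b ≤ ψ x` give `b·T₃↑(w,X)² ≤ T₆↓(w,X)` for every `X` with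
`FarWindowData θ θ' w X`. -/
theorem table_of_valueTable (Δ : ChartDictionary θ θ' w D K x₀ r₁) (hP : ∀ y ∈ K, 0 < D.P y)
    (hval : ∀ x ∈ K, r₁ ≤ ‖x - x₀‖ → b ≤ D.psi x) (hb : 0 ≤ b) :
    ∀ X : E3 →ₗ[ℝ] E3, FarWindowData θ θ' w X → b * windowSixUp w X ^ 2 ≤ windowTwelveLo w X := by
  intro X hX
  obtain ⟨-, -, μ, hmin, hatt, -⟩ := id hX
  have hxK := Δ.mem_K X μ hX hmin hatt
  exact table_of_ratio (Δ.scale_pos X μ hX hmin hatt) (windowSixUp_nonneg w X) hb (Δ.upper X μ hX hmin hatt)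
    (Δ.lower X μ hX hmin hatt) (hP _ hxK) (hval _ hxK (Δ.far X μ hX hmin hatt))

/-- ★ **The ratio table of a window from the RADIAL tables** (the sibling line, critic row 1207 (B)).  A chart
dictionary of `w`, the family's positivity on `K`, and the hypotheses of `FamilyData.radial_reduction` — (C) strong
radial convexity `m₀ ≤ ψ₂` on `K ∩ B(x₀, ρ)`, (B) the slope-or-curvature disjunction on `K ∖ B(x₀, ρ)`, (G) centre
data, the numeric side conditions — give `b·T₃↑(w,X)² ≤ T₆↓(w,X)` for every `X` with `FarWindowData θ θ' w X`. -/
theorem table_of_radialTables (Δ : ChartDictionary θ θ' w D K x₀ r₁) (hK : StarConvex ℝ x₀ K)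
    (hpos : ∀ y ∈ K, ∀ i ∈ D.s, D.c i + D.L i y ≠ 0) (hP : ∀ y ∈ K, 0 < D.P y)
    (hC : ∀ y ∈ K, ‖y - x₀‖ ≤ ρ → ∀ u : E, ‖u‖ = 1 → m₀ ≤ D.psi₂ y u)
    (hB : ∀ y ∈ K, ρ ≤ ‖y - x₀‖ →
      0 < D.psi₁ y (‖y - x₀‖⁻¹ • (y - x₀)) ∨ 0 < D.psi₂ y (‖y - x₀‖⁻¹ • (y - x₀)))
    (hG : ∀ u : E, ‖u‖ = 1 → -η ≤ D.psi₁ x₀ u) (h0 : b - δ₀ ≤ D.psi x₀)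
    (hr₁ : 0 < r₁) (hrρ : r₁ ≤ ρ)
    (hq : ∀ t ∈ Icc r₁ ρ, δ₀ + η * t ≤ m₀ / 2 * t ^ 2) (hρη : η < m₀ * ρ) (hb : 0 ≤ b) :
    ∀ X : E3 →ₗ[ℝ] E3, FarWindowData θ θ' w X → b * windowSixUp w X ^ 2 ≤ windowTwelveLo w X :=
  table_of_valueTable Δ hP (D.radial_reduction hK hpos (fun y hy => (hP y hy).ne') hC hB hG h0 hr₁ hrρ hq hρη) hb

end Window

/-! ## §4 The assembly over the windows: `hcert` verbatim, and Z2 -/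

section Assembly

variable {θ θ' b : ℝ}

/-- ◇◇ **The `hcert` binder of `farCoreExcess_of_hcpEnclosures`, verbatim, from the ratio tables of all windows**
(`κ″ = 1/(2·10⁷) + 10⁻⁹`, `0 ≤ l3² − 24κ″·L6hi`, `L6hi ≤ b·(l3² − 24κ″·L6hi)`); each window's ratio table comes from
`table_of_valueTable` or `table_of_radialTables`, at the planner's choice per class. -/
theorem hcert_of_ratioTables
    (h : ∀ (w : Fin 6 → ℤ) (X : E3 →ₗ[ℝ] E3), FarWindowData θ θ' w X → b * windowSixUp w X ^ 2 ≤ windowTwelveLo w X)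
    {l3 L6hi : ℝ} (hD : 0 ≤ l3 ^ 2 - 24 * (1 / (2 * 10 ^ 7) + 1 / 10 ^ 9) * L6hi)
    (hbD : L6hi ≤ b * (l3 ^ 2 - 24 * (1 / (2 * 10 ^ 7) + 1 / 10 ^ 9) * L6hi)) :
    ∀ (w : Fin 6 → ℤ) (X : E3 →ₗ[ℝ] E3), FarWindowData θ θ' w X →
      windowSixUp w X ^ 2 * L6hi ≤ (l3 ^ 2 - 24 * (1 / (2 * 10 ^ 7) + 1 / 10 ^ 9) * L6hi) * windowTwelveLo w X :=
  fun w X hX => cert_of_table hD hbD (h w X hX)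

/-- ◇◇◇ **Z2 `FarCoreExcess (1/25) (1/2000) (1/(2·10⁷))` from the hcp reference enclosures and the ratio tables of
all windows at `θ = 1/25`, `θ' = 1/2000 − τ`**: `farCoreExcess_of_hcpEnclosures` ∘ `hcert_of_ratioTables`. -/
theorem farCoreExcess_of_ratioTables {c τ l3 L6hi : ℝ} (hc : c ≠ 0) (hτ : 0 < τ) (hτ' : τ ≤ 1 / 100)
    (hl3 : 0 < l3) (hL3 : l3 ≤ StackingSums.hcpInvPowSum 3 c) (hL6 : StackingSums.hcpInvPowSum 6 c ≤ L6hi)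
    (hκ : 24 * (1 / (2 * 10 ^ 7) + 1 / 10 ^ 9) * L6hi ≤ l3 ^ 2)
    (h : ∀ (w : Fin 6 → ℤ) (X : E3 →ₗ[ℝ] E3), FarWindowData (1 / 25) (1 / 2000 - τ) w X →
      b * windowSixUp w X ^ 2 ≤ windowTwelveLo w X)
    (hbD : L6hi ≤ b * (l3 ^ 2 - 24 * (1 / (2 * 10 ^ 7) + 1 / 10 ^ 9) * L6hi)) :
    FarCoreExcess (1 / 25) (1 / 2000) (1 / (2 * 10 ^ 7)) :=
  farCoreExcess_of_hcpEnclosures hc hτ hτ' hl3 hL3 hL6 hκ (hcert_of_ratioTables h (sub_nonneg.2 hκ) hbD)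

end Assembly

/-! ## §5 End to end: (D1) `hcert` — and Z2 — from per-window chart dictionaries and RADIAL tables -/

section EndToEnd

variable {E : Type*} [NormedAddCommGroup E] [NormedSpace ℝ E] {ι : Type*} {θ θ' b : ℝ}
  {D : (Fin 6 → ℤ) → FamilyData E ι} {K : (Fin 6 → ℤ) → Set E} {x₀ : (Fin 6 → ℤ) → E}
  {ρ m₀ η δ₀ r₁ : (Fin 6 → ℤ) → ℝ}

/-- ★★ **(D1) The `hcert` binder of `farCoreExcess_of_hcpEnclosures`, VERBATIM, from `FamilyData.radial_reduction`
and a chart dictionary per window**: families `D w`, regions `K w` (star-convex about the centres `x₀ w`), radii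
`r₁ w ≤ ρ w`, constants `m₀ w, η w, δ₀ w`, the tables (C)/(B)/(G) of every window, the numeric side conditions,
`0 ≤ b` and `L6hi ≤ b·(l3² − 24κ″·L6hi)`, `0 ≤ l3² − 24κ″·L6hi`. -/
theorem hcert_of_radialTables (Δ : ∀ w, ChartDictionary θ θ' w (D w) (K w) (x₀ w) (r₁ w))
    (hK : ∀ w, StarConvex ℝ (x₀ w) (K w))
    (hpos : ∀ w, ∀ y ∈ K w, ∀ i ∈ (D w).s, (D w).c i + (D w).L i y ≠ 0) (hP : ∀ w, ∀ y ∈ K w, 0 < (D w).P y)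
    (hC : ∀ w, ∀ y ∈ K w, ‖y - x₀ w‖ ≤ ρ w → ∀ u : E, ‖u‖ = 1 → m₀ w ≤ (D w).psi₂ y u)
    (hB : ∀ w, ∀ y ∈ K w, ρ w ≤ ‖y - x₀ w‖ →
      0 < (D w).psi₁ y (‖y - x₀ w‖⁻¹ • (y - x₀ w)) ∨ 0 < (D w).psi₂ y (‖y - x₀ w‖⁻¹ • (y - x₀ w)))
    (hG : ∀ w, ∀ u : E, ‖u‖ = 1 → -η w ≤ (D w).psi₁ (x₀ w) u) (h0 : ∀ w, b - δ₀ w ≤ (D w).psi (x₀ w))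
    (hr₁ : ∀ w, 0 < r₁ w) (hrρ : ∀ w, r₁ w ≤ ρ w)
    (hq : ∀ w, ∀ t ∈ Icc (r₁ w) (ρ w), δ₀ w + η w * t ≤ m₀ w / 2 * t ^ 2) (hρη : ∀ w, η w < m₀ w * ρ w)
    (hb : 0 ≤ b) {l3 L6hi : ℝ} (hD : 0 ≤ l3 ^ 2 - 24 * (1 / (2 * 10 ^ 7) + 1 / 10 ^ 9) * L6hi)
    (hbD : L6hi ≤ b * (l3 ^ 2 - 24 * (1 / (2 * 10 ^ 7) + 1 / 10 ^ 9) * L6hi)) :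
    ∀ (w : Fin 6 → ℤ) (X : E3 →ₗ[ℝ] E3), FarWindowData θ θ' w X →
      windowSixUp w X ^ 2 * L6hi ≤ (l3 ^ 2 - 24 * (1 / (2 * 10 ^ 7) + 1 / 10 ^ 9) * L6hi) * windowTwelveLo w X :=
  hcert_of_ratioTables (fun w => table_of_radialTables (Δ w) (hK w) (hpos w) (hP w) (hC w) (hB w) (hG w) (h0 w)
    (hr₁ w) (hrρ w) (hq w) (hρη w) hb) hD hbD

/-- ★★★ **Z2 `FarCoreExcess (1/25) (1/2000) (1/(2·10⁷))` from the hcp reference enclosures, a chart dictionary per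
window at `θ = 1/25`, `θ' = 1/2000 − τ`, and the radial tables** — the sibling CERT-line of critic row 1207 (B)
typed end to end: `farCoreExcess_of_hcpEnclosures` ∘ `hcert_of_radialTables`. -/
theorem farCoreExcess_of_radialTables {c τ l3 L6hi : ℝ} (hc : c ≠ 0) (hτ : 0 < τ) (hτ' : τ ≤ 1 / 100)
    (hl3 : 0 < l3) (hL3 : l3 ≤ StackingSums.hcpInvPowSum 3 c) (hL6 : StackingSums.hcpInvPowSum 6 c ≤ L6hi)
    (hκ : 24 * (1 / (2 * 10 ^ 7) + 1 / 10 ^ 9) * L6hi ≤ l3 ^ 2)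
    (Δ : ∀ w, ChartDictionary (1 / 25) (1 / 2000 - τ) w (D w) (K w) (x₀ w) (r₁ w))
    (hK : ∀ w, StarConvex ℝ (x₀ w) (K w))
    (hpos : ∀ w, ∀ y ∈ K w, ∀ i ∈ (D w).s, (D w).c i + (D w).L i y ≠ 0) (hP : ∀ w, ∀ y ∈ K w, 0 < (D w).P y)
    (hC : ∀ w, ∀ y ∈ K w, ‖y - x₀ w‖ ≤ ρ w → ∀ u : E, ‖u‖ = 1 → m₀ w ≤ (D w).psi₂ y u)
    (hB : ∀ w, ∀ y ∈ K w, ρ w ≤ ‖y - x₀ w‖ →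
      0 < (D w).psi₁ y (‖y - x₀ w‖⁻¹ • (y - x₀ w)) ∨ 0 < (D w).psi₂ y (‖y - x₀ w‖⁻¹ • (y - x₀ w)))
    (hG : ∀ w, ∀ u : E, ‖u‖ = 1 → -η w ≤ (D w).psi₁ (x₀ w) u) (h0 : ∀ w, b - δ₀ w ≤ (D w).psi (x₀ w))
    (hr₁ : ∀ w, 0 < r₁ w) (hrρ : ∀ w, r₁ w ≤ ρ w)
    (hq : ∀ w, ∀ t ∈ Icc (r₁ w) (ρ w), δ₀ w + η w * t ≤ m₀ w / 2 * t ^ 2) (hρη : ∀ w, η w < m₀ w * ρ w)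
    (hb : 0 ≤ b) (hbD : L6hi ≤ b * (l3 ^ 2 - 24 * (1 / (2 * 10 ^ 7) + 1 / 10 ^ 9) * L6hi)) :
    FarCoreExcess (1 / 25) (1 / 2000) (1 / (2 * 10 ^ 7)) :=
  farCoreExcess_of_hcpEnclosures hc hτ hτ' hl3 hL3 hL6 hκ
    (hcert_of_radialTables Δ hK hpos hP hC hB hG h0 hr₁ hrρ hq hρη hb (sub_nonneg.2 hκ) hbD)

end EndToEnd

end Summit.AtomisticToContinuum.Crystallization.Theorems.OverbindingBudgetAffineRadialGlue
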